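import Summits.HodgeConjecture.HodgeConjecture.Theses.OG6CharacterSectors

/-!
# Route `OG6CharacterSectors` — support item `FourierInversion` (stmt-HodgeConjecture-9358)

CHARACTER ORTHOGONALITY for an OG6 frame `(X, g)`, `g : (ℤ/2)⁸ → Aut X` with `g 0 = 𝟙`:
`Σ_a e_a c = c` on every `Hᵏ(X(ℂ); ℂ)`, where `e_a = (1/256) Σ_b (-1)^{a·b} g_b^*`.  Pure algebra:
`Σ_a (-1)^{a·b} = 256·[b = 0]` on `(Fin 8 → ZMod 2)` (factorise over the eight coordinates), then
`g 0 = 𝟙` and `complexBetti.map_id`.  Only the conjunct `g 0 = 𝟙 X` of the frame hypothesis is used.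
No definition, no named-fact hypothesis, no sorry.
-/

set_option linter.dupNamespace false

noncomputable section

namespace Summit.HodgeConjecture.HodgeConjecture.Theorems

open scoped BigOperators
open CategoryTheory Literature.AlgebraicGeometry.HodgeTheory

/-- One coordinate of the character sum: `Σ_{x ∈ ℤ/2} (-1)^{(x y).val} = 2·[y = 0]`. -/
theorem og6_coordCharSum (y : ZMod 2) :
    ∑ x : ZMod 2, (-1 : ℂ) ^ (x * y).val = if y = 0 then 2 else 0 := by
  have h : ∑ x : ZMod 2, (-1 : ℤ) ^ (x * y).val = if y = 0 then 2 else 0 := by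
    revert y
    decide
  have h' := congrArg (Int.cast : ℤ → ℂ) h
  push_cast at h'
  exact h'

/-- Orthogonality of the characters of `(ℤ/2)⁸`: `Σ_a (-1)^{Σ_i (a_i b_i).val} = 256·[b = 0]`. -/
theorem og6_charSum (b : Fin 8 → ZMod 2) :
    ∑ a : Fin 8 → ZMod 2, (-1 : ℂ) ^ (∑ i : Fin 8, (a i * b i).val) =
      if b = 0 then 256 else 0 := by
  simp_rw [← Finset.prod_pow_eq_pow_sum]
  rw [← Fintype.prod_sum (fun i (x : ZMod 2) => (-1 : ℂ) ^ (x * b i).val)]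
  simp_rw [og6_coordCharSum]
  split_ifs with hb
  · subst hb
    simp only [Pi.zero_apply, if_true, Finset.prod_const, Finset.card_univ, Fintype.card_fin]
    norm_num
  · obtain ⟨i, hi⟩ : ∃ i, b i ≠ 0 := Function.ne_iff.mp hb
    exact Finset.prod_eq_zero (Finset.mem_univ i) (if_neg hi)

/-- **Item stmt-HodgeConjecture-9358 (`FourierInversion`, route `OG6CharacterSectors`)**: for an OG6
frame `(X, g)`, `Σ_a e_a c = c` on every `Hᵏ(X(ℂ); ℂ)` with `e_a c = (1/256) Σ_b (-1)^{a·b} g_b^* c` —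
character orthogonality `Σ_a (-1)^{a·b} = 256·[b = 0]` plus `g 0 = 𝟙`, `(𝟙)^* = 𝟙`.  The type is
literally the route decl `Summit.HodgeConjecture.HodgeConjecture.Theses.OG6CharacterSectors.FourierInversion`.
[cite: Floccari2023, §1] -/
theorem og6CharacterSectors_fourierInversion_proof :
    Summit.HodgeConjecture.HodgeConjecture.Theses.OG6CharacterSectors.FourierInversion := by
  unfold Summit.HodgeConjecture.HodgeConjecture.Theses.OG6CharacterSectors.FourierInversion
  intro X g hFr k c
  have hg0 : g 0 = 𝟙 X := hFr.2.2.2.2.2.1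
  -- exchange the sums and evaluate the character sum
  calc ∑ a : Fin 8 → ZMod 2, ((1 / 256 : ℂ) • ∑ b : Fin 8 → ZMod 2,
          ((-1 : ℂ) ^ (∑ i : Fin 8, (a i * b i).val)) • complexBetti.map (g b) k c)
      = (1 / 256 : ℂ) • ∑ b : Fin 8 → ZMod 2, (∑ a : Fin 8 → ZMod 2,
          (-1 : ℂ) ^ (∑ i : Fin 8, (a i * b i).val)) • complexBetti.map (g b) k c := by
        rw [← Finset.smul_sum, Finset.sum_comm]
        simp_rw [Finset.sum_smul]
    _ = (1 / 256 : ℂ) • ∑ b : Fin 8 → ZMod 2,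
          (if b = 0 then (256 : ℂ) else 0) • complexBetti.map (g b) k c := by
        simp_rw [og6_charSum]
    _ = c := by
        simp_rw [ite_smul, zero_smul, Finset.sum_ite_eq', Finset.mem_univ, if_true, smul_smul]
        rw [hg0, complexBetti.map_id]
        norm_num

end Summit.HodgeConjecture.HodgeConjecture.Theorems

end
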